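import Mathlib
import Literature.Probability.LatticeModels.ThermodynamicLimit
import Literature.Probability.LatticeModels.SharpnessProofs
import HarnessLib

/-!
# Helpers (II) for stub `stub_rieszGaussian` of line `diffusive-branch-is-nonsaturation`
(crux `PrecisionLaplacian.DirectCorrelationStableTail`, item stmt-CriticalPhenomena-4799)

**The subordinated weight.**  After Gaussian subordination (file (I), `…RieszGaussianAux`), the
Riesz–Fourier integral `D(u)` becomes `κ ∫_0^∞ w_t(s) (1 − e^{-A_s} cos B_s) ds` with the weight

  `w_t(s) = s^{β-1} (s+t)^{-3/2} e^{-q/(4(s+t))}`,  `q = |k|₂² > 0`, `0 < β < 3/2`, `t ≥ 0`.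

This file (pure one-variable real analysis, `import Mathlib` only) provides
(registered helper sub-goal `stub_rieszGaussian_auxSIntegral`):
* the uniform bound `x^{-3/2} e^{-q/(4x)} ≤ L` on `(0,∞)` (`rieszG_profile_bound`, from
  `e^y ≥ 1 + y + y²/2`), hence `0 ≤ w_t(s) ≤ min(L s^{β-1}, s^{β-1}s^{-3/2})` (`rieszG_w_le`);
* integrability of this `t`-independent dominator on `(0,∞)` (`rieszG_dom_integrableOn`), hence
  integrability of `w_t` and `∫ w_t ≤ ∫ dominator` uniformly in `t ≥ 0` (`rieszG_w_integral_le`);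
* dominated convergence `∫ w_t → ∫ w_0` as `t → 0⁺` (`rieszG_w_tendsto`);
* the scaling `∫ w_0 = q^{β-3/2} ∫_0^∞ s^{β-1}s^{-3/2}e^{-1/(4s)} ds` (`rieszG_w0_scaling`, substitution
  `s ↦ q s`) and positivity of these integrals (`rieszG_w0_pos`).

With `β = (3-α)/2` the scaling exponent is `β − 3/2 = −α/2`, which is what makes the limiting symbol
`C_α |k|^{-α}` with `C_α` independent of `k`.  All statements are folklore; no definitions are
introduced.
-/

noncomputable section

namespace Summit.CriticalPhenomena.Ising3DConformalLimit.Cruxes.DirectCorrelationStableTail.DiffusiveBranchIsNonsaturation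

open MeasureTheory Filter Topology Set
open scoped BigOperators

/-- Uniform bound of the profile `x^{-3/2} e^{-q/(4x)}` on `(0, ∞)`. [folklore] -/
theorem rieszG_profile_bound {q : ℝ} (hq : 0 < q) :
    ∃ L : ℝ, 0 < L ∧ ∀ x : ℝ, 0 < x → x ^ (-(3 / 2 : ℝ)) * Real.exp (-q / (4 * x)) ≤ L := by
  refine ⟨1 + 32 / q ^ 2, by positivity, fun x hx => ?_⟩
  have hxn : 0 ≤ x ^ (-(3 / 2 : ℝ)) := Real.rpow_nonneg hx.le _
  have hy : 0 < q / (4 * x) := by positivity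
  -- `e^{-y} ≤ 2 / y²`
  have hexp : Real.exp (-q / (4 * x)) ≤ 32 * x ^ 2 / q ^ 2 := by
    have h1 : 1 + q / (4 * x) + (q / (4 * x)) ^ 2 / 2 ≤ Real.exp (q / (4 * x)) :=
      Real.quadratic_le_exp_of_nonneg hy.le
    have h2 : (q / (4 * x)) ^ 2 / 2 ≤ Real.exp (q / (4 * x)) := by nlinarith
    rw [neg_div, Real.exp_neg]
    calc (Real.exp (q / (4 * x)))⁻¹ ≤ ((q / (4 * x)) ^ 2 / 2)⁻¹ :=
          inv_anti₀ (by positivity) h2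
      _ = 32 * x ^ 2 / q ^ 2 := by field_simp; ring
  have hexp1 : Real.exp (-q / (4 * x)) ≤ 1 := by
    rw [Real.exp_le_one_iff, neg_div, neg_nonpos]
    exact hy.le
  rcases le_or_gt 1 x with hx1 | hx1
  · -- `x ≥ 1`: `x^{-3/2} ≤ 1`
    have : x ^ (-(3 / 2 : ℝ)) ≤ 1 := Real.rpow_le_one_of_one_le_of_nonpos hx1 (by norm_num)
    calc x ^ (-(3 / 2 : ℝ)) * Real.exp (-q / (4 * x)) ≤ 1 * 1 :=
          mul_le_mul this hexp1 (Real.exp_pos _).le zero_le_one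
      _ ≤ 1 + 32 / q ^ 2 := by rw [one_mul]; exact le_add_of_nonneg_right (by positivity)
  · -- `x < 1`: `x^{-3/2} x² = x^{1/2} ≤ 1`
    have hpow : x ^ (-(3 / 2 : ℝ)) * x ^ 2 ≤ 1 := by
      rw [← Real.rpow_two, ← Real.rpow_add hx]
      exact Real.rpow_le_one hx.le hx1.le (by norm_num)
    calc x ^ (-(3 / 2 : ℝ)) * Real.exp (-q / (4 * x))
        ≤ x ^ (-(3 / 2 : ℝ)) * (32 * x ^ 2 / q ^ 2) := mul_le_mul_of_nonneg_left hexp hxn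
      _ = (x ^ (-(3 / 2 : ℝ)) * x ^ 2) * (32 / q ^ 2) := by ring
      _ ≤ 1 * (32 / q ^ 2) := mul_le_mul_of_nonneg_right hpow (by positivity)
      _ ≤ 1 + 32 / q ^ 2 := by rw [one_mul]; exact le_add_of_nonneg_left zero_le_one

/-- Pointwise bounds of the subordinated weight `w_t(s) = s^{β-1}(s+t)^{-3/2}e^{-q/(4(s+t))}`:
`0 ≤ w_t(s) ≤ min(L s^{β-1}, s^{β-1}s^{-3/2})` for `s > 0`, `t ≥ 0`. [folklore] -/
theorem rieszG_w_le {β q L t s : ℝ} (hq : 0 ≤ q)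
    (hL : ∀ x : ℝ, 0 < x → x ^ (-(3 / 2 : ℝ)) * Real.exp (-q / (4 * x)) ≤ L)
    (ht : 0 ≤ t) (hs : 0 < s) :
    0 ≤ s ^ (β - 1) * (s + t) ^ (-(3 / 2 : ℝ)) * Real.exp (-q / (4 * (s + t))) ∧
    s ^ (β - 1) * (s + t) ^ (-(3 / 2 : ℝ)) * Real.exp (-q / (4 * (s + t))) ≤
      min (L * s ^ (β - 1)) (s ^ (β - 1) * s ^ (-(3 / 2 : ℝ))) := by
  have hst : 0 < s + t := by linarith
  have h1 : 0 ≤ s ^ (β - 1) := Real.rpow_nonneg hs.le _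
  have h2 : 0 ≤ (s + t) ^ (-(3 / 2 : ℝ)) := Real.rpow_nonneg hst.le _
  have h3 := (Real.exp_pos (-q / (4 * (s + t)))).le
  refine ⟨mul_nonneg (mul_nonneg h1 h2) h3, le_min ?_ ?_⟩
  · rw [mul_assoc, mul_comm L]
    exact mul_le_mul_of_nonneg_left (hL (s + t) hst) h1
  · rw [mul_assoc]
    refine mul_le_mul_of_nonneg_left ?_ h1
    have h4 : (s + t) ^ (-(3 / 2 : ℝ)) ≤ s ^ (-(3 / 2 : ℝ)) :=
      Real.rpow_le_rpow_of_nonpos hs (by linarith) (by norm_num)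
    have h5 : Real.exp (-q / (4 * (s + t))) ≤ 1 := by
      rw [Real.exp_le_one_iff, neg_div, neg_nonpos]
      positivity
    calc (s + t) ^ (-(3 / 2 : ℝ)) * Real.exp (-q / (4 * (s + t))) ≤ s ^ (-(3 / 2 : ℝ)) * 1 :=
          mul_le_mul h4 h5 h3 (Real.rpow_nonneg hs.le _)
      _ = s ^ (-(3 / 2 : ℝ)) := mul_one _

/-- The dominator `min(L s^{β-1}, s^{β-1}s^{-3/2})` is integrable on `(0,∞)` for `0 < β < 3/2`.
[folklore] -/
theorem rieszG_dom_integrableOn {β : ℝ} (hβ0 : 0 < β) (hβ1 : β < 3 / 2) {L : ℝ} (hL : 0 ≤ L) :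
    IntegrableOn (fun s : ℝ => min (L * s ^ (β - 1)) (s ^ (β - 1) * s ^ (-(3 / 2 : ℝ))))
      (Ioi 0) := by
  have hmeas : Measurable (fun s : ℝ =>
      min (L * s ^ (β - 1)) (s ^ (β - 1) * s ^ (-(3 / 2 : ℝ)))) :=
    Measurable.min (by fun_prop) (by fun_prop)
  have hnn : ∀ s : ℝ, 0 < s → 0 ≤ min (L * s ^ (β - 1)) (s ^ (β - 1) * s ^ (-(3 / 2 : ℝ))) :=
    fun s hs => le_min (mul_nonneg hL (Real.rpow_nonneg hs.le _))
      (mul_nonneg (Real.rpow_nonneg hs.le _) (Real.rpow_nonneg hs.le _))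
  rw [← Ioc_union_Ioi_eq_Ioi zero_le_one, integrableOn_union]
  constructor
  · have hIoc : IntegrableOn (fun s : ℝ => L * s ^ (β - 1)) (Ioc 0 1) :=
      ((intervalIntegrable_iff_integrableOn_Ioc_of_le zero_le_one).1
        (intervalIntegral.intervalIntegrable_rpow' (by linarith))).const_mul L
    refine Integrable.mono' hIoc hmeas.aestronglyMeasurable ?_
    filter_upwards [ae_restrict_mem measurableSet_Ioc] with s hs
    rw [Real.norm_of_nonneg (hnn s hs.1)]
    exact min_le_left _ _
  · have hIoi : IntegrableOn (fun s : ℝ => s ^ (β - 1) * s ^ (-(3 / 2 : ℝ))) (Ioi 1) := by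
      refine (integrableOn_Ioi_rpow_of_lt (by linarith : β - 1 + -(3 / 2 : ℝ) < -1)
        one_pos).congr_fun (fun s hs => ?_) measurableSet_Ioi
      exact Real.rpow_add (by linarith [hs.out]) _ _
    refine Integrable.mono' hIoi hmeas.aestronglyMeasurable ?_
    filter_upwards [ae_restrict_mem measurableSet_Ioi] with s hs
    rw [Real.norm_of_nonneg (hnn s (by linarith [hs.out]))]
    exact min_le_right _ _

/-- Integrability of `w_t` on `(0,∞)` and the uniform bound `∫ w_t ≤ ∫ dominator`. [folklore] -/
theorem rieszG_w_integral_le {β q L t : ℝ} (hβ0 : 0 < β) (hβ1 : β < 3 / 2) (hq : 0 ≤ q)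
    (hL0 : 0 ≤ L) (hL : ∀ x : ℝ, 0 < x → x ^ (-(3 / 2 : ℝ)) * Real.exp (-q / (4 * x)) ≤ L)
    (ht : 0 ≤ t) :
    IntegrableOn (fun s : ℝ => s ^ (β - 1) * (s + t) ^ (-(3 / 2 : ℝ)) *
        Real.exp (-q / (4 * (s + t)))) (Ioi 0) ∧
    ∫ s in Ioi (0 : ℝ), s ^ (β - 1) * (s + t) ^ (-(3 / 2 : ℝ)) * Real.exp (-q / (4 * (s + t))) ≤
      ∫ s in Ioi (0 : ℝ), min (L * s ^ (β - 1)) (s ^ (β - 1) * s ^ (-(3 / 2 : ℝ))) := by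
  have hdom := rieszG_dom_integrableOn hβ0 hβ1 hL0
  have hmeas : Measurable (fun s : ℝ => s ^ (β - 1) * (s + t) ^ (-(3 / 2 : ℝ)) *
      Real.exp (-q / (4 * (s + t)))) := by fun_prop
  have hbd : ∀ᵐ s ∂(volume.restrict (Ioi (0 : ℝ))),
      ‖s ^ (β - 1) * (s + t) ^ (-(3 / 2 : ℝ)) * Real.exp (-q / (4 * (s + t)))‖ ≤
        min (L * s ^ (β - 1)) (s ^ (β - 1) * s ^ (-(3 / 2 : ℝ))) := by
    filter_upwards [ae_restrict_mem measurableSet_Ioi] with s hs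
    have h := rieszG_w_le (β := β) hq hL ht hs
    rw [Real.norm_of_nonneg h.1]
    exact h.2
  have hint : IntegrableOn (fun s : ℝ => s ^ (β - 1) * (s + t) ^ (-(3 / 2 : ℝ)) *
      Real.exp (-q / (4 * (s + t)))) (Ioi 0) :=
    Integrable.mono' hdom hmeas.aestronglyMeasurable hbd
  refine ⟨hint, integral_mono_ae hint hdom ?_⟩
  filter_upwards [ae_restrict_mem measurableSet_Ioi] with s hs
  exact (rieszG_w_le (β := β) hq hL ht hs).2

/-- Dominated convergence: `∫ w_t → ∫ w_0` as `t → 0⁺`. [folklore] -/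
theorem rieszG_w_tendsto {β q : ℝ} (hβ0 : 0 < β) (hβ1 : β < 3 / 2) (hq : 0 < q) :
    Tendsto (fun t : ℝ => ∫ s in Ioi (0 : ℝ), s ^ (β - 1) * (s + t) ^ (-(3 / 2 : ℝ)) *
        Real.exp (-q / (4 * (s + t)))) (𝓝[>] 0)
      (𝓝 (∫ s in Ioi (0 : ℝ), s ^ (β - 1) * s ^ (-(3 / 2 : ℝ)) * Real.exp (-q / (4 * s)))) := by
  obtain ⟨L, hL0, hL⟩ := rieszG_profile_bound hq
  refine tendsto_integral_filter_of_dominated_convergence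
    (fun s => min (L * s ^ (β - 1)) (s ^ (β - 1) * s ^ (-(3 / 2 : ℝ)))) ?_ ?_
    (rieszG_dom_integrableOn hβ0 hβ1 hL0.le) ?_
  · exact Eventually.of_forall fun t => (by fun_prop : Measurable fun s : ℝ =>
      s ^ (β - 1) * (s + t) ^ (-(3 / 2 : ℝ)) * Real.exp (-q / (4 * (s + t)))).aestronglyMeasurable
  · filter_upwards [self_mem_nhdsWithin] with t ht
    filter_upwards [ae_restrict_mem measurableSet_Ioi] with s hs
    have h := rieszG_w_le (β := β) hq.le hL (le_of_lt ht) hs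
    rw [Real.norm_of_nonneg h.1]
    exact h.2
  · filter_upwards [ae_restrict_mem measurableSet_Ioi] with s hs
    have hs' : (0 : ℝ) < s := hs
    have hc : ContinuousAt (fun t : ℝ => s ^ (β - 1) * (s + t) ^ (-(3 / 2 : ℝ)) *
        Real.exp (-q / (4 * (s + t)))) 0 := by
      have h1 : ContinuousAt (fun t : ℝ => s + t) 0 := by fun_prop
      have h2 : ContinuousAt (fun t : ℝ => (s + t) ^ (-(3 / 2 : ℝ))) 0 :=
        h1.rpow_const (Or.inl (by simp [hs'.ne']))
      have h3 : ContinuousAt (fun t : ℝ => Real.exp (-q / (4 * (s + t)))) 0 :=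
        ((continuousAt_const.div (continuousAt_const.mul h1) (by simp [hs'.ne']))).rexp
      exact (continuousAt_const.mul h2).mul h3
    have := hc.tendsto
    simp only [add_zero] at this
    exact tendsto_nhdsWithin_of_tendsto_nhds this

/-- Scaling out `q` (substitution `s ↦ q s`):
`∫_0^∞ s^{β-1}s^{-3/2}e^{-q/(4s)} ds = q^{β-3/2} ∫_0^∞ s^{β-1}s^{-3/2}e^{-1/(4s)} ds`. [folklore] -/
theorem rieszG_w0_scaling {β q : ℝ} (hq : 0 < q) :
    ∫ s in Ioi (0 : ℝ), s ^ (β - 1) * s ^ (-(3 / 2 : ℝ)) * Real.exp (-q / (4 * s)) =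
      q ^ (β - 3 / 2) *
        ∫ s in Ioi (0 : ℝ), s ^ (β - 1) * s ^ (-(3 / 2 : ℝ)) * Real.exp (-1 / (4 * s)) := by
  have h := integral_comp_mul_left_Ioi
    (fun s : ℝ => s ^ (β - 1) * s ^ (-(3 / 2 : ℝ)) * Real.exp (-q / (4 * s))) 0 hq
  rw [mul_zero] at h
  have hl : ∫ x in Ioi (0 : ℝ), (q * x) ^ (β - 1) * (q * x) ^ (-(3 / 2 : ℝ)) *
      Real.exp (-q / (4 * (q * x))) =
      q ^ (β - 1) * q ^ (-(3 / 2 : ℝ)) *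
        ∫ x in Ioi (0 : ℝ), x ^ (β - 1) * x ^ (-(3 / 2 : ℝ)) * Real.exp (-1 / (4 * x)) := by
    rw [← integral_const_mul]
    refine setIntegral_congr_fun measurableSet_Ioi fun x hx => ?_
    have hx' : (0 : ℝ) < x := hx
    rw [Real.mul_rpow hq.le hx'.le, Real.mul_rpow hq.le hx'.le]
    have : -q / (4 * (q * x)) = -1 / (4 * x) := by field_simp
    rw [this]
    ring
  rw [hl] at h
  -- `h : q^(β-1) q^(-3/2) ∫ g = q⁻¹ • ∫ f`
  rw [smul_eq_mul] at h
  have hq0 : q ≠ 0 := hq.ne'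
  calc ∫ s in Ioi (0 : ℝ), s ^ (β - 1) * s ^ (-(3 / 2 : ℝ)) * Real.exp (-q / (4 * s))
      = q * (q ^ (β - 1) * q ^ (-(3 / 2 : ℝ)) *
          ∫ x in Ioi (0 : ℝ), x ^ (β - 1) * x ^ (-(3 / 2 : ℝ)) * Real.exp (-1 / (4 * x))) := by
        rw [h]; field_simp
    _ = q ^ (β - 3 / 2) *
          ∫ x in Ioi (0 : ℝ), x ^ (β - 1) * x ^ (-(3 / 2 : ℝ)) * Real.exp (-1 / (4 * x)) := by
        rw [show β - 3 / 2 = 1 + (β - 1) + -(3 / 2 : ℝ) by ring, Real.rpow_add hq,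
          Real.rpow_add hq, Real.rpow_one]
        ring

/-- Positivity of `∫_0^∞ s^{β-1}s^{-3/2}e^{-q/(4s)} ds` (`0 < β < 3/2`, `q > 0`). [folklore] -/
theorem rieszG_w0_pos {β q : ℝ} (hβ0 : 0 < β) (hβ1 : β < 3 / 2) (hq : 0 < q) :
    0 < ∫ s in Ioi (0 : ℝ), s ^ (β - 1) * s ^ (-(3 / 2 : ℝ)) * Real.exp (-q / (4 * s)) := by
  obtain ⟨L, hL0, hL⟩ := rieszG_profile_bound hq
  have hint := (rieszG_w_integral_le hβ0 hβ1 hq.le hL0.le hL le_rfl).1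
  simp only [add_zero] at hint
  have hpos : ∀ s : ℝ, 0 < s → 0 < s ^ (β - 1) * s ^ (-(3 / 2 : ℝ)) * Real.exp (-q / (4 * s)) :=
    fun s hs => mul_pos (mul_pos (Real.rpow_pos_of_pos hs _) (Real.rpow_pos_of_pos hs _))
      (Real.exp_pos _)
  rw [setIntegral_pos_iff_support_of_nonneg_ae ?_ hint]
  · have hsub : Ioi (0 : ℝ) ⊆ Function.support
        (fun s : ℝ => s ^ (β - 1) * s ^ (-(3 / 2 : ℝ)) * Real.exp (-q / (4 * s))) ∩ Ioi 0 :=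
      fun s hs => ⟨(hpos s hs).ne', hs⟩
    calc (0 : ENNReal) < volume (Ioi (0 : ℝ)) := by simp
      _ ≤ _ := measure_mono hsub
  · filter_upwards [ae_restrict_mem measurableSet_Ioi] with s hs
    exact (hpos s hs).le

/-- **Registered helper sub-goal `stub_rieszGaussian_auxSIntegral`** of stub `stub_rieszGaussian`
(line `diffusive-branch-is-nonsaturation`, crux stmt-CriticalPhenomena-4799): for `0 < β < 3/2` and
`q > 0`, the subordinated weight `w_t(s) = s^{β-1}(s+t)^{-3/2}e^{-q/(4(s+t))}` satisfies
(i) `∫_0^∞ w_0 > 0`, (ii) the scaling `∫ w_0 = q^{β-3/2} ∫_0^∞ s^{β-1}s^{-3/2}e^{-1/(4s)} ds`,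
(iii) `∫ w_t → ∫ w_0` as `t → 0⁺`, and (iv) a uniform profile bound `L` with
`0 ≤ w_t ≤ min(L s^{β-1}, s^{β-1}s^{-3/2})`, `w_t` integrable and `∫ w_t ≤ ∫ min(…) < ∞` for all
`t ≥ 0`. [folklore] -/
theorem stub_rieszGaussian_auxSIntegral :
    ∀ (β q : ℝ), 0 < β → β < 3 / 2 → 0 < q →
      (0 < ∫ s in Set.Ioi (0 : ℝ), s ^ (β - 1) * s ^ (-(3 / 2 : ℝ)) * Real.exp (-q / (4 * s))) ∧
      (∫ s in Set.Ioi (0 : ℝ), s ^ (β - 1) * s ^ (-(3 / 2 : ℝ)) * Real.exp (-q / (4 * s)) =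
        q ^ (β - 3 / 2) *
          ∫ s in Set.Ioi (0 : ℝ), s ^ (β - 1) * s ^ (-(3 / 2 : ℝ)) * Real.exp (-1 / (4 * s))) ∧
      Filter.Tendsto (fun t : ℝ => ∫ s in Set.Ioi (0 : ℝ), s ^ (β - 1) * (s + t) ^ (-(3 / 2 : ℝ)) *
          Real.exp (-q / (4 * (s + t)))) (nhdsWithin 0 (Set.Ioi 0))
        (nhds (∫ s in Set.Ioi (0 : ℝ), s ^ (β - 1) * s ^ (-(3 / 2 : ℝ)) * Real.exp (-q / (4 * s)))) ∧
      (∃ L : ℝ, 0 < L ∧ (∀ x : ℝ, 0 < x → x ^ (-(3 / 2 : ℝ)) * Real.exp (-q / (4 * x)) ≤ L) ∧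
        MeasureTheory.IntegrableOn
          (fun s : ℝ => min (L * s ^ (β - 1)) (s ^ (β - 1) * s ^ (-(3 / 2 : ℝ)))) (Set.Ioi 0) ∧
        ∀ t : ℝ, 0 ≤ t →
          MeasureTheory.IntegrableOn (fun s : ℝ => s ^ (β - 1) * (s + t) ^ (-(3 / 2 : ℝ)) *
            Real.exp (-q / (4 * (s + t)))) (Set.Ioi 0) ∧
          (∫ s in Set.Ioi (0 : ℝ), s ^ (β - 1) * (s + t) ^ (-(3 / 2 : ℝ)) *
              Real.exp (-q / (4 * (s + t))) ≤
            ∫ s in Set.Ioi (0 : ℝ), min (L * s ^ (β - 1)) (s ^ (β - 1) * s ^ (-(3 / 2 : ℝ)))) ∧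
          ∀ s : ℝ, 0 < s →
            0 ≤ s ^ (β - 1) * (s + t) ^ (-(3 / 2 : ℝ)) * Real.exp (-q / (4 * (s + t))) ∧
            s ^ (β - 1) * (s + t) ^ (-(3 / 2 : ℝ)) * Real.exp (-q / (4 * (s + t))) ≤
              min (L * s ^ (β - 1)) (s ^ (β - 1) * s ^ (-(3 / 2 : ℝ)))) := by
  intro β q hβ0 hβ1 hq
  obtain ⟨L, hL0, hL⟩ := rieszG_profile_bound hq
  exact ⟨rieszG_w0_pos hβ0 hβ1 hq, rieszG_w0_scaling hq, rieszG_w_tendsto hβ0 hβ1 hq,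
    L, hL0, hL, rieszG_dom_integrableOn hβ0 hβ1 hL0.le, fun t ht =>
      ⟨(rieszG_w_integral_le hβ0 hβ1 hq.le hL0.le hL ht).1,
        (rieszG_w_integral_le hβ0 hβ1 hq.le hL0.le hL ht).2,
        fun s hs => rieszG_w_le (β := β) hq.le hL ht hs⟩⟩

end Summit.CriticalPhenomena.Ising3DConformalLimit.Cruxes.DirectCorrelationStableTail.DiffusiveBranchIsNonsaturation

end
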